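import Summits.FinalStateConjecture.FinalStateConjecture.Theses.PhotonSphereChannels
import Summits.FinalStateConjecture.FinalStateConjecture.Theorems.PhotonSphereChannelsChannelsResolveTameDevelopmentsRRayClauseSplit
import Summits.FinalStateConjecture.FinalStateConjecture.Cruxes.ChannelsResolveTameDevelopmentsR.Lines.tame_lasalle_dock
import HarnessLib.Audit

/-!
# Strategy census s6 (independent family `s`) — Lean companion of `STRATEGY-CENSUS-s6.md`
# crux `PhotonSphereChannels.ChannelsResolveTameDevelopmentsR` (stmt-FinalStateConjecture-17430, K2R-T2)

Seat planner-cstrat-stmt-FinalStateConjecture-17430-s6-0 (2026-08-17). Kernel-checked content, no `sorry`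
of its own (the imported skeleton `Lines/tame_lasalle_dock.lean` carries the registered sorried stubs; only
its DEFINITIONS and sorry-free theorems are used here):

* §1 WEAKER INTERMEDIATES FROM THE SUMMIT. The route's deciding theorem `closes : K1R → K2R → K3 → S`
  consumes K2R only through the generic property `Q` of K3, by monotonicity of tame Christodoulou-genericity
  in the property. Hence for EVERY predicate `H` on maximal developments the pair
  `K2R_H := (hyps ∧ H ⇒ resolution)` / `K3_H := Gen(Q ∧ H)` still decides the summit
  (`finalStateConjecture_of_given`), `K2R ⇒ K2R_H` for every `H` (`resolvesGiven_of_crux`), `H := ⊤` is the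
  route as filed (`crux_iff_resolvesGiven_top`, `tameCensorship_iff_given_top`) and `H := resolution` is the
  summit with tameness folded in (`resolvesGiven_resolves`). The family interpolates between the route and the
  summit; a weaker intermediate has teeth only if `K2R_H` is attackable by a NAMED tool while `K3_H` stays
  plausible — the census (§A of the .md) walks the candidates.
* §2 THE SWEET SPOT `H := KerrHull` (every silent hull element of the development is Minkowski or an exact
  sub-extremal Kerr d.o.c., one `(M, a)` per generator — the antecedent of the registered stub T′ verbatim):
  `K2R_KerrHull` follows from the two registered BOOKKEEPING stubs T′ `TameEndgame` and C
  `SettledExteriorHoldsRays` (= item stmt-17673) alone (`resolvesGiven_kerrHull_of_endgame_of_rays`), i.e. it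
  contains none of the rigidity (SEK / items 10034, 10745). What moves into `K3_KerrHull` is exactly
  "GENERIC developments have only Kerr/Minkowski ω-limits" — generic no-hair, which the summit needs anyway,
  instead of the ∀-data no-hair that K2R as typed implies (census §A.3, §E).
* §3 THE DOCK, REPAIRED. `SilentEternalIsKerr` (SEK) as registered concludes on `docOfEnd (range Φ)` for an
  arbitrary far chart `Φ`, binder-for-binder the shape of item stmt-10745, which is refuted-misstated as typed
  (×3, horizon-penetrating far chart; evidence `Cprime.lean`/`UPrime.lean` on 10745). `SilentEternalIsKerrFar`
  is the `∃ R₁`-repair (conclude on the d.o.c. of the FAR PART `Φ '' {R₁ < r}`); `silentEternalIsKerrFar_of`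
  records that SEK as typed implies it (so nothing landed against SEK′ is lost) — the converse is the false
  direction. The census (§C) says what must be re-threaded in the line (`E.doc`).
-/

set_option maxSynthPendingDepth 3
set_option linter.dupNamespace false

noncomputable section

open Set Filter Function TopologicalSpace
open scoped Topology Manifold ContDiff ENNReal NNReal

namespace Summit.FinalStateConjecture.FinalStateConjecture.Cruxes.ChannelsResolveTameDevelopmentsR.CensusS6

open Literature.Geometry.Lorentzian
open Summit.FinalStateConjecture.FinalStateConjecture.Theses.PhotonSphereChannels
  (ChannelsResolveTameDevelopmentsR UniformPhotonSphereChannelsR TameCensorship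
    UniformPhotonSphereChannelsR_holds)
open Summit.FinalStateConjecture.FinalStateConjecture.Theorems
open Summit.FinalStateConjecture.FinalStateConjecture.Theorems.TameHull
open Summit.FinalStateConjecture.FinalStateConjecture.Cruxes.ChannelsResolveTameDevelopmentsR.TameLaSalleDock
  (TameEndgame SettledExteriorHoldsRays SilentEternalIsKerr)

/-! ### §1 Weaker intermediates from the summit: the `H`-family -/

/-- A predicate on vacuum Cauchy developments of data on a `3`-manifold (the slot `H`). [folklore] -/
abbrev DevPred : Type 1 :=
  ∀ (X : Type) [TopologicalSpace X] [ChartedSpace E3 X] [IsManifold (𝓡 3) ∞ X] [T2Space X]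
    [SecondCountableTopology X] [ConnectedSpace X] (D : InitialDataSet (𝓡 3) X),
    VacuumCauchyDevelopment D → Prop

section PerDevelopment

variable {X : Type} [TopologicalSpace X] [ChartedSpace E3 X] [IsManifold (𝓡 3) ∞ X] [T2Space X]
  [SecondCountableTopology X] [ConnectedSpace X] {D : InitialDataSet (𝓡 3) X}

/-- The consequent of K2R-T2 at one development, verbatim: an honest, ray-holding, exhaustive,
future-oriented `C²` final-state decomposition. [cite: DafermosLuk2017, Conjecture 1] -/
def Resolves (𝒟 : VacuumCauchyDevelopment D) : Prop :=
  ∃ (O : Set 𝒟.carrier) (d : FinalStateDecomposition 𝒟.toSpacetime O 2),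
    O = _root_.Summit.FinalStateConjecture.exteriorOf 𝒟.toCauchyDevelopment d.charted ∧
      _root_.Summit.FinalStateConjecture.RaysStayInClosure 𝒟.toCauchyDevelopment O ∧
        _root_.Summit.FinalStateConjecture.HasExhaustiveCharts d ∧
          _root_.Summit.FinalStateConjecture.IsFutureOriented d

/-- Hypotheses (i) ∧ (ii) of K2R-T2 at one development (verbatim, via the `TrappedSet` copies that the
landed `RayClause` split uses). [cite: DafermosLuk2017, §1.2.1] -/
def Hyps (𝒟 : VacuumCauchyDevelopment D) : Prop :=
  TrappedSet.NoExtremalRemnant 𝒟 ∧ TrappedSet.TameOuterRegion 𝒟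

end PerDevelopment

/-- **K2R_H** — the crux with the extra hypothesis `H` on the development (and the theorem `K1R`
dropped from the antecedent). [cite: DafermosLuk2017, Conjecture 1] -/
def ResolvesGiven (H : DevPred) : Prop :=
  ∀ (X : Type) [TopologicalSpace X] [ChartedSpace E3 X] [IsManifold (𝓡 3) ∞ X] [T2Space X]
    [SecondCountableTopology X] [ConnectedSpace X], ∀ D ∈ admissibleVacuumData X,
    ∀ 𝒟 : VacuumCauchyDevelopment D, 𝒟.IsMaximal →
      _root_.Summit.FinalStateConjecture.HasCompleteNullInfinity 𝒟.toCauchyDevelopment →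
        Hyps 𝒟 → H X D 𝒟 → Resolves 𝒟

/-- **K3_H** — tame censorship with `H` folded into the generic property. [cite: Christodoulou1999, p. A24] -/
def TameCensorshipGiven (H : DevPred) : Prop :=
  ∀ (X : Type) [TopologicalSpace X] [ChartedSpace E3 X] [IsManifold (𝓡 3) ∞ X] [T2Space X]
    [SecondCountableTopology X] [ConnectedSpace X],
    InitialDataSet.IsTameChristodoulouGeneric (admissibleVacuumData X)
      (fun D ↦ (∃ 𝒟 : VacuumCauchyDevelopment D, 𝒟.IsMaximal) ∧
        ∀ 𝒟 : VacuumCauchyDevelopment D, 𝒟.IsMaximal →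
          _root_.Summit.FinalStateConjecture.HasCompleteNullInfinity 𝒟.toCauchyDevelopment ∧
            Hyps 𝒟 ∧ H X D 𝒟) 1

/-- The trivial slot. [folklore] -/
abbrev topPred : DevPred := fun _ _ _ _ _ _ _ _ _ ↦ True

/-- The resolution slot (top of the family). [folklore] -/
abbrev resolvesPred : DevPred := fun _ _ _ _ _ _ _ _ 𝒟 ↦ Resolves 𝒟

/-- Monotonicity of tame Christodoulou-genericity in the property (the step `closes` performs):
keeping the witnessing end, family, tameness and immersion, only exceptional-set membership is
transported. [cite: Christodoulou1999, p. A24] -/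
theorem isTameChristodoulouGeneric_mono {X : Type} [TopologicalSpace X] [ChartedSpace E3 X]
    [IsManifold (𝓡 3) ∞ X] [T2Space X] [SecondCountableTopology X] [ConnectedSpace X]
    {P Q : InitialDataSet (𝓡 3) X → Prop}
    (hQP : ∀ D ∈ admissibleVacuumData X, Q D → P D)
    (hQ : InitialDataSet.IsTameChristodoulouGeneric (admissibleVacuumData X) Q 1) :
    InitialDataSet.IsTameChristodoulouGeneric (admissibleVacuumData X) P 1 := by
  intro D hD
  obtain ⟨e, F, hF, himm, h0, hinj, hadm, hexc⟩ := hQ D ⟨hD.1, fun h => hD.2 (hQP D hD.1 h)⟩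
  exact ⟨e, F, hF, himm, h0, hinj, hadm,
    fun c hc hmem => hexc c hc ⟨hmem.1, fun h => hmem.2 (hQP _ hmem.1 h)⟩⟩

/-- **Every weaker intermediate still decides the summit.** For every `H`:
`K2R_H → K3_H → FinalStateConjecture` — the proof of `closes`, with `H` threaded through. So the crux
is REPLACEABLE by any `K2R_H` at the sole cost of strengthening K3 to `K3_H`. [cite: DafermosLuk2017, Conjecture 1] -/
theorem finalStateConjecture_of_given (H : DevPred) (h₂ : ResolvesGiven H)
    (h₃ : TameCensorshipGiven H) : _root_.FinalStateConjecture := by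
  intro X _ _ _ _ _ _
  refine isTameChristodoulouGeneric_mono ?_ (h₃ X)
  rintro D hD ⟨hex, hQ⟩
  refine ⟨hex, fun 𝒟 hmax => ?_⟩
  obtain ⟨hcomp, hyp, hH⟩ := hQ 𝒟 hmax
  obtain ⟨O, d, hO, hrays, hexh, hfo⟩ := h₂ X D hD 𝒟 hmax hcomp hyp hH
  exact ⟨hcomp, O, d,
    ChannelsResolveTameDevelopmentsR.RayClause.isSubextremal_of_noExtremalRemnant hyp.1 d,
    hO, hrays, hexh, hfo⟩

/-- `K2R ⇒ K2R_H` for every `H` (K1R is a theorem, `UniformPhotonSphereChannelsR_holds`). [folklore] -/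
theorem resolvesGiven_of_crux (H : DevPred) (h : ChannelsResolveTameDevelopmentsR) : ResolvesGiven H :=
  fun X _ _ _ _ _ _ D hD 𝒟 hmax hcomp hyp _ ↦
    h UniformPhotonSphereChannelsR_holds X D hD 𝒟 hmax hcomp hyp

/-- `H := ⊤` is the crux as filed (modulo the proved antecedent K1R). [folklore] -/
theorem crux_iff_resolvesGiven_top : ChannelsResolveTameDevelopmentsR ↔ ResolvesGiven topPred :=
  ⟨resolvesGiven_of_crux topPred,
    fun h _ X _ _ _ _ _ _ D hD 𝒟 hmax hcomp hyp ↦ h X D hD 𝒟 hmax hcomp hyp trivial⟩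

/-- `H := ⊤` is K3 as filed. [folklore] -/
theorem tameCensorship_iff_given_top : TameCensorship ↔ TameCensorshipGiven topPred := by
  constructor
  · intro h X _ _ _ _ _ _
    refine isTameChristodoulouGeneric_mono ?_ (h X)
    rintro D - ⟨hex, hQ⟩
    exact ⟨hex, fun 𝒟 hmax ↦ ⟨(hQ 𝒟 hmax).1, (hQ 𝒟 hmax).2, trivial⟩⟩
  · intro h X _ _ _ _ _ _
    refine isTameChristodoulouGeneric_mono ?_ (h X)
    rintro D - ⟨hex, hQ⟩
    exact ⟨hex, fun 𝒟 hmax ↦ ⟨(hQ 𝒟 hmax).1, (hQ 𝒟 hmax).2.1⟩⟩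

/-- Top of the family: `K2R_{resolution}` is a tautology, so `K3_{resolution}` alone is the summit with
tameness folded in — the family interpolates from the route (`⊤`) to the summit. [folklore] -/
theorem resolvesGiven_resolves : ResolvesGiven resolvesPred :=
  fun _ _ _ _ _ _ _ _ _ _ _ _ _ h ↦ h

/-- … hence `K3_{resolution} → FinalStateConjecture` with no second crux at all. [folklore] -/
theorem finalStateConjecture_of_tameCensorshipGiven_resolves (h : TameCensorshipGiven resolvesPred) :
    _root_.FinalStateConjecture :=
  finalStateConjecture_of_given resolvesPred resolvesGiven_resolves h

/-- Monotonicity of the family in `H`: a stronger side hypothesis gives a weaker `K2R_H` … [folklore] -/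
theorem resolvesGiven_mono {H H' : DevPred}
    (hle : ∀ (X : Type) [TopologicalSpace X] [ChartedSpace E3 X] [IsManifold (𝓡 3) ∞ X] [T2Space X]
      [SecondCountableTopology X] [ConnectedSpace X] (D : InitialDataSet (𝓡 3) X)
      (𝒟 : VacuumCauchyDevelopment D), H' X D 𝒟 → H X D 𝒟)
    (h : ResolvesGiven H) : ResolvesGiven H' :=
  fun X _ _ _ _ _ _ D hD 𝒟 hmax hcomp hyp hH' ↦ h X D hD 𝒟 hmax hcomp hyp (hle X D 𝒟 hH')

/-- … and a stronger `K3_H`. [folklore] -/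
theorem tameCensorshipGiven_mono {H H' : DevPred}
    (hle : ∀ (X : Type) [TopologicalSpace X] [ChartedSpace E3 X] [IsManifold (𝓡 3) ∞ X] [T2Space X]
      [SecondCountableTopology X] [ConnectedSpace X] (D : InitialDataSet (𝓡 3) X)
      (𝒟 : VacuumCauchyDevelopment D), H' X D 𝒟 → H X D 𝒟)
    (h : TameCensorshipGiven H') : TameCensorshipGiven H := by
  intro X _ _ _ _ _ _
  refine isTameChristodoulouGeneric_mono ?_ (h X)
  rintro D - ⟨hex, hQ⟩
  exact ⟨hex, fun 𝒟 hmax ↦ ⟨(hQ 𝒟 hmax).1, (hQ 𝒟 hmax).2.1, hle X D 𝒟 (hQ 𝒟 hmax).2.2⟩⟩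

/-! ### §2 The sweet spot `H := KerrHull`: the crux minus its rigidity core is bookkeeping -/

/-- **`KerrHull`** — the antecedent of the registered stub T′ `TameEndgame`, as a slot predicate: the outer
region is nonempty and there is an all-orders class `(Λ, r₀)` with outer and generator hulls in which
EVERY silent outer hull element is Minkowski or an exact sub-extremal Kerr d.o.c. and every generator
path carries ONE sub-extremal `(M, a)` fitting all its horizon-hull elements. This is what the line
`tame-lasalle-dock` extracts from A″ + SEK + D + N + K♭; as a HYPOTHESIS it is the dynamical form of
"the ω-limit set of the development consists of Kerr exteriors". [cite: DafermosLuk2017, Conjecture 1] -/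
def kerrHullPred : DevPred := fun _ _ _ _ _ _ _ _ 𝒟 ↦
  ∀ [𝒟.metric.HasLeviCivita], (outerRegion 𝒟).Nonempty ∧
    ∃ (Λ : ℕ → ℝ≥0) (r₀ : ℝ), 0 < r₀ ∧ OuterHullExists 𝒟 Λ r₀ ∧ GeneratorHullExists 𝒟 Λ r₀ ∧
      (∀ (q : ℕ → 𝒟.carrier) (𝓢 : Spacetime.{0} 4) (E : EndDatum 𝓢) (p : 𝓢.carrier),
        IsSilentHullElement 𝒟 Λ r₀ q 𝓢 E p →
          IsMinkowski 𝓢 ∨ ∃ M a : ℝ, 0 < M ∧ |a| < M ∧ IsKerrDoc 𝓢 E.doc M a) ∧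
      (∀ γ : ℝ → 𝒟.carrier, IsHorizonPath 𝒟 γ → ∃ M a : ℝ, 0 < M ∧ |a| < M ∧
        ∀ (𝓢 : Spacetime.{0} 4) (E : EndDatum 𝓢) (p : 𝓢.carrier),
          IsHorizonHullElement 𝒟 Λ r₀ γ 𝓢 E p → IsKerrDoc 𝓢 E.doc M a)

/-- **`K2R_KerrHull` is bookkeeping**: it follows from the registered stubs T′ (`TameEndgame`, the XL
chart-gluing endgame) and C (`SettledExteriorHoldsRays` = item stmt-17673) ALONE — no SEK, no item
10034/10745, no hull producer. Sorry-free over the two stub STATEMENTS as hypotheses. [cite: DafermosLuk2017, Conjecture 1] -/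
theorem resolvesGiven_kerrHull_of_endgame_of_rays (hT : TameEndgame) (hC : SettledExteriorHoldsRays) :
    ResolvesGiven kerrHullPred := by
  intro X _ _ _ _ _ _ D hD 𝒟 hmax hcomp hyp hH
  haveI : 𝒟.metric.HasLeviCivita := 𝒟.metric.toPseudoRiemannianMetric.hasLeviCivita
  have hdev : DevHyp 𝒟 := ⟨hmax, hcomp, hyp.1, hyp.2⟩
  obtain ⟨hne, hclass⟩ := hH
  obtain ⟨O, d, hO, hexh, hfo⟩ := hT X D hD 𝒟 hdev hne hclass
  exact ⟨O, d, hO, hC X D hD 𝒟 hmax hcomp O d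
    (ChannelsResolveTameDevelopmentsR.RayClause.isSubextremal_of_noExtremalRemnant hyp.1 d) hO hexh hfo,
    hexh, hfo⟩

/-- **The re-keyed route closes**: `T′ → C → K3_KerrHull → FinalStateConjecture`. Everything the route
files as the rigidity of silent eternal vacua (SEK and its docks) has moved to the GENERIC side, where
the summit needs it only generically. [cite: DafermosLuk2017, Conjecture 1] -/
theorem finalStateConjecture_of_endgame_of_rays_of_genericKerrHull (hT : TameEndgame)
    (hC : SettledExteriorHoldsRays) (h₃ : TameCensorshipGiven kerrHullPred) : _root_.FinalStateConjecture :=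
  finalStateConjecture_of_given kerrHullPred (resolvesGiven_kerrHull_of_endgame_of_rays hT hC) h₃

/-! ### §3 The dock, repaired: conclude on the d.o.c. of the far part of the chart -/

/-- **SEK′ — `SilentEternalIsKerrFar`**: the registered dock `SilentEternalIsKerr` with its conclusion
re-anchored to the FAR PART of the chart: for some `R₁` the domain of outer communications of
`Φ '' {R₁ < r}` (not of `range Φ`) is an exact Kerr exterior `0 < M'`, `|a| ≤ M'`, or the spacetime is
Minkowski. The horizon-penetrating Schwarzschild chart that refutes item stmt-10745 / SEK as typed
(`docOfEnd (range Φ)` then contains interior points) satisfies SEK′ with `R₁ = 2M`. This is the shape a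
repaired U (refuter's `UPrime.lean` on stmt-10745: `Mext := Φ '' {R₁ < r}`) composes to with L.
[cite: IonescuKlainerman2009, Thm 1.1] [cite: AlexakisIonescuKlainerman2010, Thm 1.1] -/
def SilentEternalIsKerrFar : Prop :=
  ∀ (M R : ℝ) (C : ℕ → ℝ), 0 ≤ M → max (2 * M) 0 < R →
    ∀ (𝓢 : Spacetime.{0} 4) [𝓢.metric.toPseudoRiemannianMetric.HasLeviCivita] [Kerr.Facts],
      𝓢.metric.toPseudoRiemannianMetric.IsRicciFlat → 𝓢.metric.IsGloballyHyperbolic 𝓢.timeOrientation →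
      ∀ (Φ : Kerr.region (0 : ℝ) R → 𝓢.carrier), IsLocalDiffeomorph 𝓘(ℝ, E4) (𝓡 4) (⊤ : ℕ∞) Φ →
      Function.Injective Φ →
      let B : ModelBackground := ⟨Kerr.region 0 R, Kerr.bilin M 0, fun x ↦ x 0, Kerr.radius 0⟩
      let h : E4 → E4 →L[ℝ] E4 →L[ℝ] ℝ := 𝓢.deviationExtend B Φ
      let hₜ : E4 → E4 →L[ℝ] E4 →L[ℝ] ℝ := fun y ↦ fderiv ℝ h y (E4.basisVector 0)
      (∀ (m : ℕ) (x : Kerr.region (0 : ℝ) R), ‖iteratedFDeriv ℝ m h x.1‖ * Kerr.radius 0 x.1 ≤ C m) →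
      (∀ (m : ℕ), ∀ δ > (0 : ℝ), ∃ R' : ℝ, ∀ x : Kerr.region (0 : ℝ) R,
        R' < Kerr.radius 0 x.1 → ‖iteratedFDeriv ℝ m hₜ x.1‖ * Kerr.radius 0 x.1 ≤ δ) →
      ((𝓢.blackHoleRegionOfEnd (Set.range Φ)).Nonempty ∨
        (𝓢.metric.IsTimelikeGeodesicallyComplete ∧ 𝓢.metric.IsNullGeodesicallyComplete)) →
      (∃ R₁ : ℝ, R ≤ R₁ ∧ ∃ (M' a : ℝ), 0 < M' ∧ |a| ≤ M' ∧ ∃ Ψ : Kerr.exterior M' a → 𝓢.carrier,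
          Function.Injective Ψ ∧
          Set.range Ψ = 𝓢.docOfEnd (Φ '' {x | R₁ < Kerr.radius 0 x.1}) ∧
          PseudoRiemannianMetric.IsLocalIsometry
            (Kerr.smoothMetric M' a (Kerr.rPlus M' a)).toPseudoRiemannianMetric
            𝓢.metric.toPseudoRiemannianMetric Ψ) ∨
      (∃ Ψ : Diffeomorph (𝓡 4) 𝓘(ℝ, E4) 𝓢.carrier E4 (⊤ : ℕ∞),
        PseudoRiemannianMetric.IsIsometry 𝓢.metric.toPseudoRiemannianMetric
          (Minkowski.metric.ofLE le_top : LorentzianMetric 𝓘(ℝ, E4) (⊤ : ℕ∞) E4).toPseudoRiemannianMetric Ψ)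

/-- The far part `{R < r}` of the chart domain is all of it, so `Φ '' {R < r} = range Φ`. [folklore] -/
theorem image_far_eq_range {R : ℝ} {α : Type*} (Φ : Kerr.region (0 : ℝ) R → α) :
    Φ '' {x | R < Kerr.radius 0 x.1} = Set.range Φ := by
  ext y
  simp only [Set.mem_image, Set.mem_setOf_eq, Set.mem_range]
  constructor
  · rintro ⟨x, -, rfl⟩; exact ⟨x, rfl⟩
  · rintro ⟨x, rfl⟩
    exact ⟨x, Kerr.lt_radius_of_mem_region x.2, rfl⟩

/-- SEK as typed implies SEK′ (take `R₁ = R`): every support landed for the repaired dock is implied by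
the registered one, and the refuting instance separates them (the converse is the false direction).
[folklore] -/
theorem silentEternalIsKerrFar_of (h : SilentEternalIsKerr) : SilentEternalIsKerrFar := by
  intro M R C hM hR 𝓢 _ _ hRic hGH Φ hΦ hinj B hh hₜ hbd hnr hbh
  rcases h M R C hM hR 𝓢 hRic hGH Φ hΦ hinj hbd hnr hbh with ⟨M', a, hM', ha, Ψ, hΨ, hrange, hiso⟩ | hflat
  · refine Or.inl ⟨R, le_rfl, M', a, hM', ha, Ψ, hΨ, ?_, hiso⟩
    rw [image_far_eq_range]; exact hrange
  · exact Or.inr hflat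

end Summit.FinalStateConjecture.FinalStateConjecture.Cruxes.ChannelsResolveTameDevelopmentsR.CensusS6

end
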